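import Literature.Analysis.FluidPDE.ElgindiL12Calculus
import Literature.Analysis.FluidPDE.ElgindiGammaKNumerics
import HarnessLib

/-!
# Weighted `L²` coercivity of Elgindi's linearised fundamental model `𝓛_Γ`
([Elgindi2021] Proposition 5.5)

Topic `Literature/Analysis/FluidPDE`. Proof file (everything proved, no definitions, no named
facts) on the proof path of the named fact
`Literature.Analysis.FluidPDE.Elgindi.ElgindiGhoulMasmoudi2021_stabilityCore`
(`ElgindiStabilityDecomposition.lean`): the base case of the coercivity induction of
Elgindi–Ghoul–Masmoudi, Camb. J. Math. 9 (2021) = arXiv:1910.14071, §3 Prop. 3.2 ("We know that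
`𝓛_{F_*}^T` is coercive in `𝓗²` [E_Classical]") is T. M. Elgindi, Ann. of Math. 194 (2021) =
arXiv:1904.04795 (`[Elgindi2021]`), §5 **Proposition 5.5** (p. 15 of the held text):

> `(𝓛_Γ(f)w, fw)_{L²} ≥ ¼|fw|²_{L²}`,

for the operator `𝓛_Γ(f) = f + z∂_z f − 2f/(1+z) − (2zΓ/(c(1+z)²))L₁₂(f)` of Def. 5.1
(`Elgindi.opLΓ`, `ElgindiLinearizedOperator.lean`) and the weight `w = (1+z)²/z²` of Def. 5.2
(`Elgindi.radialWeight`), on functions with `L₁₂(f)(0) = 0` (the codimension-one condition under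
which all coercivity statements of both papers are made, [ElgindiGhoulMasmoudi2021] Prop. 3.2:
"whenever `f ∈ 𝓗ᵏ` and `L₁₂(f)(0) = 0`"; it is what makes the boundary term at `z = 0` of the
printed integration by parts vanish).

## The printed proof and the vendored one

Printed (p. 15): `(𝓛_Γ(f)w, fw) = (𝓛(f)w, fw) − 2(K(z/(1+z)²)fw², L₁₂f) − 2((Γ/c − K)(z/(1+z)²)
fw², L₁₂f) = ½|fw|² − 2(K(f/z)w, L₁₂f) − 2(fw, (Γ/c − K)L₁₂(f)/z) = ½|fw|² + (∂_z(L₁₂(f)²), w)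
− 2(fw, (Γ/c − K)L₁₂(f)/z) ≥ ½|fw|² − (L₁₂(f)², ∂_z w) − 2|fw||Γ/c − K|_{L²}|z⁻¹L₁₂f|_{L²_z} ≥
½|fw|² + 2|z⁻¹L₁₂f|² − (7/5)|fw||z⁻¹L₁₂f|`, "where we used (LW) and the definition of `w` in the
second equality, the definition of `L₁₂` in the third equality, integration by parts in the
first inequality, and (GammaAssumption) in the second inequality. Since `(7/5)² < 4(¼)(2)`, we
have `(𝓛_Γ(f)w, fw) ≥ ¼|fw|²`."

Vendored: the same chain with the splitting `Γ/c = λK + R`, **`λ = 7/5`** instead of `1` (see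
`ElgindiGammaKNumerics.lean` for why: the printed `|Γ/c − K| ≤ 7/10` holds at `α → 0` with a
margin of `0.026` only): the `K`-part is the exact derivative `λ(∂_z(L₁₂f)², w) = −λ(L₁₂(f)²,
w') = 2λ∫(L₁₂f)²(z⁻² + z⁻³) ≥ 2λ|z⁻¹L₁₂f|²`, the `R`-part is bounded pointwise by
`2|fw·R L₁₂f/z| ≤ ¼(fw)² + 4R²(L₁₂f/z)²` and Fubini (`∫∫R(θ)²(L₁₂f(z)/z)² = |R|²_{L²_θ}|z⁻¹L₁₂f|²`),
so that `(𝓛_Γ fw, fw) ≥ ½|fw|² + 2λX² − ¼|fw|² − 4|R|²X² ≥ ¼|fw|²` as soon as `|R|²_{L²} ≤ λ/2 =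
7/10` (`integral_sq_angularWeight_div_sub_le`, valid for `0 ≤ α ≤ 1/200`). The inputs
`(𝓛(f)w, fw) = ½|fw|²` (`integral_strip_opL_energy`) and "the definition of `L₁₂`"
(`hasDerivAt_L12`: `z(L₁₂f)' = −∫K f dθ`) are the previous files of this path.

## Statement proved

`Elgindi.l2Coercivity_opLΓ`: for `0 ≤ α ≤ 1/200` and `f ∈ C¹` with compact support inside the
open strip and `L₁₂(f)(0) = 0`,
`¼ ∫∫_strip (fw)² ≤ ∫∫_strip 𝓛_Γ(f)·f·w²` (Bochner integrals for `dz dθ`). The restriction to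
small `α` is a restriction relative to the printed statement (which is asserted for all
`Γ = (sin θcos²θ)^β`, `0 ≤ β ≤ 1`); only small `α` is used downstream (the theorems are for
`α < α₀`). The class `C¹_c(strip)` is the one on which [Elgindi2021] proves §5 ("The general case
will follow by approximation", proof of Lemma 5.4).
-/

noncomputable section

open MeasureTheory Set Function Real Filter
open _root_.Topology

namespace Literature.Analysis.FluidPDE

namespace Elgindi

/-! ### Continuity of functions vanishing near the singular sets -/

/-- A function on the plane which is continuous on the open strip and vanishes off a closed
subset of the strip is continuous. [folklore] -/
theorem continuous_of_continuousOn_strip {P : ℝ × ℝ → ℝ} {K : Set (ℝ × ℝ)} (hK : IsClosed K)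
    (hKs : K ⊆ strip) (hP : ContinuousOn P strip) (h0 : ∀ p ∉ K, P p = 0) : Continuous P := by
  refine continuous_iff_continuousAt.2 fun p => ?_
  by_cases hp : p ∈ K
  · exact hP.continuousAt (strip_mem_nhds (hKs hp))
  · have : P =ᶠ[𝓝 p] fun _ => 0 := by
      filter_upwards [hK.isOpen_compl.mem_nhds hp] with q hq using h0 q hq
    exact this.continuousAt

/-- A function of one variable of the form `u · M`, `u` continuous away from `0` and `M`
continuous and vanishing on `(−∞, a)` for some `a > 0`, is continuous on `ℝ`. [folklore] -/
theorem continuous_mul_of_eq_zero_lt {u M : ℝ → ℝ} (hu : ContinuousOn u {0}ᶜ) (hM : Continuous M)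
    {a : ℝ} (ha : 0 < a) (hMa : ∀ z < a, M z = 0) : Continuous fun z => u z * M z := by
  refine continuous_iff_continuousAt.2 fun z => ?_
  by_cases hz : z = 0
  · have : (fun z => u z * M z) =ᶠ[𝓝 z] fun _ => 0 := by
      filter_upwards [Iio_mem_nhds (show z < a by rw [hz]; exact ha)] with s hs
      rw [hMa s hs, mul_zero]
    exact this.continuousAt
  · exact (hu.continuousAt (isOpen_compl_singleton.mem_nhds hz)).mul hM.continuousAt

/-! ### Integration by parts against the weight `w` -/

/-- **`∫ w · (M M') dz = ∫ (1+z)z⁻³ M² dz`** for `M ∈ C¹(ℝ)` compactly supported and vanishing on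
`(−∞, a)`, `a > 0` (so that `wM²` is `C¹` across `z = 0`): `(wM²)' = w'M² + 2wMM'` integrates to
`0` and `w' = −2(1+z)/z³` — the "integration by parts in the first inequality" of the proof of
[Elgindi2021] Prop. 5.5, `(∂_z(L₁₂(f)²), w) = −(L₁₂(f)², ∂_z w)`, whose boundary term at `0`
vanishes exactly because `L₁₂(f) ≡ 0` near `0`. [cite: Elgindi2021, §5, proof of Proposition 5.5 (p. 15 of arXiv:1904.04795)] -/
theorem integral_radialWeight_mul_mul_deriv {M M' : ℝ → ℝ} (hM : ∀ z, HasDerivAt M (M' z) z)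
    (hM'c : Continuous M') (hMs : HasCompactSupport M) {a : ℝ} (ha : 0 < a)
    (hMa : ∀ z < a, M z = 0) :
    ∫ z, radialWeight z * (M z * M' z) = ∫ z, (1 + z) / z ^ 3 * M z ^ 2 := by
  have hMc : Continuous M := continuous_iff_continuousAt.2 fun z => (hM z).continuousAt
  have hM'a : ∀ z < a, M' z = 0 := by
    intro z hz
    have h0 : M =ᶠ[𝓝 z] fun _ => 0 := by
      filter_upwards [Iio_mem_nhds hz] with s hs using hMa s hs
    rw [← (hM z).deriv, h0.deriv_eq, deriv_const]
  have hwc : ContinuousOn radialWeight {0}ᶜ := by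
    unfold radialWeight
    exact ContinuousOn.div (by fun_prop) (by fun_prop) fun z hz => pow_ne_zero 2 hz
  have hw'c : ContinuousOn (fun z : ℝ => -2 * (1 + z) / z ^ 3) {0}ᶜ :=
    ContinuousOn.div (by fun_prop) (by fun_prop) fun z hz => pow_ne_zero 3 hz
  -- `H = w M²`, `H' = w' M² + w (2 M M')`
  set H : ℝ → ℝ := fun z => radialWeight z * M z ^ 2 with hH
  set H' : ℝ → ℝ := fun z => -2 * (1 + z) / z ^ 3 * M z ^ 2 + radialWeight z * (2 * M z * M' z)
    with hH'
  have hHd : ∀ z, HasDerivAt H (H' z) z := by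
    intro z
    rcases lt_or_ge z a with hz | hz
    · -- near `z` everything vanishes
      have h0 : H =ᶠ[𝓝 z] fun _ => 0 := by
        filter_upwards [Iio_mem_nhds hz] with s hs
        simp [hH, hMa s hs]
      have : H' z = 0 := by simp [hH', hMa z hz]
      rw [this]
      exact (hasDerivAt_const z (0 : ℝ)).congr_of_eventuallyEq h0
    · have hz0 : z ≠ 0 := (ha.trans_le hz).ne'
      have h1 := (hasDerivAt_radialWeight hz0).mul ((hM z).fun_pow 2)
      refine h1.congr_deriv ?_
      simp only [hH']
      ring
  have hH'c : Continuous H' := by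
    refine (continuous_mul_of_eq_zero_lt hw'c (hMc.pow 2) ha fun z hz => by
      simp [hMa z hz]).add (continuous_mul_of_eq_zero_lt hwc ?_ ha fun z hz => by
      simp [hMa z hz])
    exact (continuous_const.mul hMc).mul hM'c
  have hH's : HasCompactSupport H' := by
    refine HasCompactSupport.intro hMs.isCompact fun z hz => ?_
    have : M z = 0 := image_eq_zero_of_notMem_tsupport hz
    simp [hH', this]
  have hHs : HasCompactSupport H := by
    refine HasCompactSupport.intro hMs.isCompact fun z hz => ?_
    have : M z = 0 := image_eq_zero_of_notMem_tsupport hz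
    simp [hH, this]
  have hH0 : Tendsto H (cocompact ℝ) (𝓝 0) := hHs.is_zero_at_infty
  have key := integral_of_hasDerivAt_of_tendsto hHd (hH'c.integrable_of_hasCompactSupport hH's)
    (hH0.mono_left atBot_le_cocompact) (hH0.mono_left atTop_le_cocompact)
  rw [sub_zero] at key
  -- split `∫ H' = ∫ w'M² + 2 ∫ w M M'`
  have hi1 : Integrable fun z => -2 * (1 + z) / z ^ 3 * M z ^ 2 :=
    (continuous_mul_of_eq_zero_lt hw'c (hMc.pow 2) ha fun z hz => by
      simp [hMa z hz]).integrable_of_hasCompactSupport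
      (HasCompactSupport.intro hMs.isCompact fun z hz => by
        simp [image_eq_zero_of_notMem_tsupport hz])
  have hi2 : Integrable fun z => radialWeight z * (2 * M z * M' z) :=
    (continuous_mul_of_eq_zero_lt hwc ((continuous_const.mul hMc).mul hM'c) ha fun z hz => by
      simp [hMa z hz]).integrable_of_hasCompactSupport
      (HasCompactSupport.intro hMs.isCompact fun z hz => by
        simp [image_eq_zero_of_notMem_tsupport hz])
  have hsplit : ∫ z, H' z = (∫ z, -2 * (1 + z) / z ^ 3 * M z ^ 2) +
      ∫ z, radialWeight z * (2 * M z * M' z) := integral_add hi1 hi2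
  rw [key] at hsplit
  have e1 : ∫ z, radialWeight z * (2 * M z * M' z) = 2 * ∫ z, radialWeight z * (M z * M' z) := by
    rw [← integral_const_mul]
    congr 1
    funext z
    ring
  have e2 : ∫ z, -2 * (1 + z) / z ^ 3 * M z ^ 2 = -2 * ∫ z, (1 + z) / z ^ 3 * M z ^ 2 := by
    rw [← integral_const_mul]
    congr 1
    funext z
    ring
  rw [e1, e2] at hsplit
  linarith

/-! ### Proposition 5.5 -/

/-- **Weighted `L²` coercivity of `𝓛_Γ`** (Elgindi 2021, Proposition 5.5: "`(𝓛_Γ(f)w, fw)_{L²} ≥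
¼|fw|²_{L²}`"; the `𝓗⁰`-level base case of Elgindi–Ghoul–Masmoudi 2021, Prop. 3.2), for
`0 ≤ α ≤ 1/200` and `f ∈ C¹` compactly supported inside the open quarter strip with
`L₁₂(f)(0) = 0`: `¼ ∫∫_strip (fw)² dz dθ ≤ ∫∫_strip 𝓛_Γ(f)·f·w² dz dθ`. Proof as printed with
the splitting constant `λ = 7/5` (module docstring). [cite: Elgindi2021, §5 Proposition 5.5 (p. 15 of arXiv:1904.04795)]
[cite: ElgindiGhoulMasmoudi2021, §3 Proposition 3.2 (p. 10 of arXiv:1910.14071): the 𝓗ᵏ induction it starts] -/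
theorem l2Coercivity_opLΓ {α : ℝ} (hα : 0 ≤ α) (hα' : α ≤ 1 / 200) {f : ℝ → ℝ → ℝ}
    (hf : ContDiff ℝ 1 (uncurry f)) (hs : HasCompactSupport (uncurry f))
    (hsub : tsupport (uncurry f) ⊆ strip) (hL0 : L12 f 0 = 0) :
    (1 / 4) * ∫ p in strip, (f p.1 p.2 * radialWeight p.1) ^ 2 ≤
      ∫ p in strip, opLΓ α f p.1 p.2 * f p.1 p.2 * radialWeight p.1 ^ 2 := by
  -- notation and the basic facts on `L = L₁₂ f`, `ψ = kMoment f / z`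
  set c : ℝ := profileConst α with hc
  have hcpos : 0 < c := profileConst_pos hα
  set L : ℝ → ℝ := L12 f with hLdef
  set ψ : ℝ → ℝ := fun z => kMoment f z / z with hψ
  set R : ℝ → ℝ := fun θ => angularWeight α θ / c - 7 / 5 * kernelK θ with hR
  have hfc : Continuous (uncurry f) := hf.continuous
  obtain ⟨a, b, ha, -, hfab⟩ := exists_radial_bounds' hs hsub
  have hf0 : ∀ p : ℝ × ℝ, p ∉ tsupport (uncurry f) → f p.1 p.2 = 0 := fun p hp =>
    (image_eq_zero_of_notMem_tsupport hp : uncurry f p = 0)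
  have hf0' : ∀ p : ℝ × ℝ, p ∉ strip → f p.1 p.2 = 0 := fun p hp => hf0 p fun h => hp (hsub h)
  have hLa : ∀ z, z < a → L z = 0 := fun z hz =>
    (L12_eq_L12_zero_of_le hfc ha hfab hz.le).trans hL0
  have hLb : ∀ z, b < z → L z = 0 := fun z hz => L12_eq_zero_of_le hfc ha hfab hz.le
  have hLd : ∀ z, HasDerivAt L (-ψ z) z := hasDerivAt_L12 hfc hs hsub
  have hψc : Continuous ψ := continuous_kMoment_div hfc ha hfab
  have hLc : Continuous L := continuous_L12 hfc hs hsub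
  have hLs : HasCompactSupport L := by
    refine HasCompactSupport.intro (isCompact_Icc (a := a) (b := b)) fun z hz => ?_
    rcases not_and_or.1 (fun h => hz ⟨h.1, h.2⟩ : ¬(a ≤ z ∧ z ≤ b)) with h | h
    · exact hLa z (not_le.1 h)
    · exact hLb z (not_le.1 h)
  have hKc : IsCompact (tsupport (uncurry f)) := hs
  have hKcl : IsClosed (tsupport (uncurry f)) := isClosed_tsupport _
  have hwon : ContinuousOn (fun p : ℝ × ℝ => radialWeight p.1) strip := by
    unfold radialWeight
    exact ContinuousOn.div (by fun_prop) (by fun_prop) fun p hp => pow_ne_zero 2 (ne_of_gt hp.1)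
  have hLon : ContinuousOn (fun p : ℝ × ℝ => L p.1) strip := (hLc.comp continuous_fst).continuousOn
  have hfon : ContinuousOn (fun p : ℝ × ℝ => f p.1 p.2) strip := hfc.continuousOn
  have hdzon : ContinuousOn (fun p : ℝ × ℝ => Dz f p.1 p.2) strip :=
    (continuous_fst.mul (continuous_dz hf)).continuousOn
  -- the four integrands
  set P₁ : ℝ × ℝ → ℝ := fun p => opL f p.1 p.2 * f p.1 p.2 * radialWeight p.1 ^ 2 with hP₁
  set P₂ : ℝ × ℝ → ℝ := fun p => 2 * p.1 * angularWeight α p.2 / (c * (1 + p.1) ^ 2) * L p.1 *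
    f p.1 p.2 * radialWeight p.1 ^ 2 with hP₂
  set QK : ℝ × ℝ → ℝ := fun p => kernelK p.2 * f p.1 p.2 * (radialWeight p.1 / p.1 * L p.1) with hQK
  set QR : ℝ × ℝ → ℝ := fun p => R p.2 * f p.1 p.2 * (radialWeight p.1 / p.1 * L p.1) with hQR
  -- each is continuous with compact support (continuous on the strip, zero off `tsupport f`)
  have cP₁ : Continuous P₁ := by
    refine continuous_of_continuousOn_strip hKcl hsub ?_ fun p hp => by simp [hP₁, hf0 p hp]
    have hopL : ContinuousOn (fun p : ℝ × ℝ => opL f p.1 p.2) strip := by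
      simp only [opL_apply]
      refine (hfon.add hdzon).sub ?_
      exact (hfon.const_smul (2 : ℝ) |>.congr fun p _ => by simp [smul_eq_mul]).div
        (by fun_prop) fun p hp => by have : (0 : ℝ) < p.1 := hp.1; positivity
    exact (hopL.mul hfon).mul (hwon.pow 2)
  have cP₂ : Continuous P₂ := by
    refine continuous_of_continuousOn_strip hKcl hsub ?_ fun p hp => by simp [hP₂, hf0 p hp]
    have h1 : ContinuousOn (fun p : ℝ × ℝ => 2 * p.1 * angularWeight α p.2 / (c * (1 + p.1) ^ 2))
        strip := by
      refine ContinuousOn.div ?_ (by fun_prop) fun p hp => ?_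
      · exact (continuous_const.mul continuous_fst).mul
          ((continuous_angularWeight hα).comp continuous_snd) |>.continuousOn
      · have : (0 : ℝ) < p.1 := hp.1
        exact mul_ne_zero hcpos.ne' (by positivity)
    exact ((h1.mul hLon).mul hfon).mul (hwon.pow 2)
  have hwzon : ContinuousOn (fun p : ℝ × ℝ => radialWeight p.1 / p.1 * L p.1) strip :=
    (hwon.div continuousOn_fst fun p hp => ne_of_gt hp.1).mul hLon
  have cQK : Continuous QK := by
    refine continuous_of_continuousOn_strip hKcl hsub ?_ fun p hp => by simp [hQK, hf0 p hp]
    exact ((continuous_kernelK.comp continuous_snd).continuousOn.mul hfon).mul hwzon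
  have hRc : Continuous R := ((continuous_angularWeight hα).div_const _).sub
    (continuous_const.mul continuous_kernelK)
  have cQR : Continuous QR := by
    refine continuous_of_continuousOn_strip hKcl hsub ?_ fun p hp => by simp [hQR, hf0 p hp]
    exact ((hRc.comp continuous_snd).continuousOn.mul hfon).mul hwzon
  have sP₁ : HasCompactSupport P₁ := HasCompactSupport.intro hKc fun p hp => by simp [hP₁, hf0 p hp]
  have sP₂ : HasCompactSupport P₂ := HasCompactSupport.intro hKc fun p hp => by simp [hP₂, hf0 p hp]
  have sQK : HasCompactSupport QK := HasCompactSupport.intro hKc fun p hp => by simp [hQK, hf0 p hp]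
  have sQR : HasCompactSupport QR := HasCompactSupport.intro hKc fun p hp => by simp [hQR, hf0 p hp]
  have iP₁ : Integrable P₁ := cP₁.integrable_of_hasCompactSupport sP₁
  have iP₂ : Integrable P₂ := cP₂.integrable_of_hasCompactSupport sP₂
  have iQK : Integrable QK := cQK.integrable_of_hasCompactSupport sQK
  have iQR : Integrable QR := cQR.integrable_of_hasCompactSupport sQR
  -- Step 1: `𝓛_Γ f · f · w² = P₁ − P₂` and the energy identity
  have step1 : ∫ p in strip, opLΓ α f p.1 p.2 * f p.1 p.2 * radialWeight p.1 ^ 2 =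
      (1 / 2) * (∫ p in strip, (f p.1 p.2 * radialWeight p.1) ^ 2) - ∫ p in strip, P₂ p := by
    rw [← integral_strip_opL_energy hf hs hsub, ← integral_sub iP₁.integrableOn iP₂.integrableOn]
    refine setIntegral_congr_fun measurableSet_strip fun p _ => ?_
    simp only [hP₁, hP₂, opLΓ_apply]
    ring
  -- Step 2: `P₂ = (14/5) Q_K + 2 Q_R` on the strip
  have step2 : ∫ p in strip, P₂ p = (14 / 5) * (∫ p in strip, QK p) + 2 * ∫ p in strip, QR p := by
    rw [← integral_const_mul, ← integral_const_mul,
      ← integral_add (iQK.integrableOn.const_mul _) (iQR.integrableOn.const_mul _)]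
    refine setIntegral_congr_fun measurableSet_strip fun p hp => ?_
    have hz : p.1 ≠ 0 := ne_of_gt hp.1
    have hz1 : 1 + p.1 ≠ 0 := by have : (0 : ℝ) < p.1 := hp.1; positivity
    simp only [hP₂, hQK, hQR, hR]
    unfold radialWeight
    field_simp
    ring
  -- Step 3: Fubini for `Q_K`: `∫∫ Q_K = ∫ (w/z) L · kMoment f dz = ∫ w L ψ dz`
  have hmomR : ∀ z, ∫ θ, kernelK θ * f z θ = kMoment f z := by
    intro z
    rw [kMoment_def, ← setIntegral_eq_integral_of_forall_compl_eq_zero (s := Ioo 0 (π / 2))]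
    · exact integral_congr_ae (Eventually.of_forall fun θ => by ring)
    · intro θ hθ
      have : f z θ = 0 := hf0' (z, θ) fun h => hθ h.2
      simp [this]
  have step3 : ∫ p in strip, QK p = ∫ z, radialWeight z * (L z * ψ z) := by
    rw [setIntegral_eq_integral_of_forall_compl_eq_zero fun p hp => by simp [hQK, hf0' p hp],
      Measure.volume_eq_prod, integral_prod _ (by rw [← Measure.volume_eq_prod]; exact iQK)]
    refine integral_congr_ae (Eventually.of_forall fun z => ?_)
    have e : ∀ θ, QK (z, θ) = (radialWeight z / z * L z) * (kernelK θ * f z θ) := fun θ => by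
      simp only [hQK]; ring
    simp_rw [e]
    rw [integral_const_mul, hmomR z]
    by_cases hz : z = 0
    · simp [hz, hLa 0 ha]
    · simp only [hψ]
      field_simp
  -- Step 4: integration by parts, `∫ w L ψ = −∫ w L L' = ∫ (1+z)/z³ L²`... with `L' = −ψ`
  have step4 : ∫ z, radialWeight z * (L z * ψ z) = -∫ z, (1 + z) / z ^ 3 * L z ^ 2 := by
    have h := integral_radialWeight_mul_mul_deriv hLd (hψc.neg) hLs ha hLa
    have e : ∫ z, radialWeight z * (L z * -ψ z) = -∫ z, radialWeight z * (L z * ψ z) := by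
      rw [← integral_neg]
      exact integral_congr_ae (Eventually.of_forall fun z => by ring)
    rw [e] at h
    linarith
  -- Step 5: `∫ (1+z)/z³ L² ≥ ∫ (L/z)² =: X2`
  set X2 : ℝ := ∫ z, (L z / z) ^ 2 with hX2
  have hu1 : ContinuousOn (fun z : ℝ => (1 + z) / z ^ 3) {0}ᶜ :=
    ContinuousOn.div (by fun_prop) (by fun_prop) fun z hz => pow_ne_zero 3 hz
  have hu2 : ContinuousOn (fun z : ℝ => 1 / z ^ 2) {0}ᶜ :=
    ContinuousOn.div (by fun_prop) (by fun_prop) fun z hz => pow_ne_zero 2 hz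
  have hL2a : ∀ z < a, L z ^ 2 = 0 := fun z hz => by simp [hLa z hz]
  have c5a : Continuous fun z => (1 + z) / z ^ 3 * L z ^ 2 :=
    continuous_mul_of_eq_zero_lt hu1 (hLc.pow 2) ha hL2a
  have c5b : Continuous fun z => 1 / z ^ 2 * L z ^ 2 :=
    continuous_mul_of_eq_zero_lt hu2 (hLc.pow 2) ha hL2a
  have hLz0 : ∀ z, z ∉ tsupport L → L z ^ 2 = 0 := fun z hz => by
    simp [image_eq_zero_of_notMem_tsupport hz]
  have i5a : Integrable fun z => (1 + z) / z ^ 3 * L z ^ 2 :=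
    c5a.integrable_of_hasCompactSupport (HasCompactSupport.intro hLs.isCompact fun z hz => by
      simp [hLz0 z hz])
  have i5b : Integrable fun z => 1 / z ^ 2 * L z ^ 2 :=
    c5b.integrable_of_hasCompactSupport (HasCompactSupport.intro hLs.isCompact fun z hz => by
      simp [hLz0 z hz])
  have hX2' : X2 = ∫ z, 1 / z ^ 2 * L z ^ 2 := by
    simp only [hX2]
    exact integral_congr_ae (Eventually.of_forall fun z => by ring)
  have step5 : X2 ≤ ∫ z, (1 + z) / z ^ 3 * L z ^ 2 := by
    rw [hX2']
    refine integral_mono i5b i5a fun z => ?_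
    rcases lt_or_ge z a with hz | hz
    · simp [hLa z hz]
    · have hz0 : 0 < z := ha.trans_le hz
      have : 1 / z ^ 2 ≤ (1 + z) / z ^ 3 := by
        rw [div_le_div_iff₀ (by positivity) (by positivity)]
        nlinarith [pow_pos hz0 2]
      exact mul_le_mul_of_nonneg_right this (sq_nonneg _)
  have hX2nn : 0 ≤ X2 := integral_nonneg fun z => sq_nonneg _
  -- Step 6: the `R`-part: `2|∫∫ Q_R| ≤ ¼ A + 4 ρ X2`
  set A : ℝ := ∫ p in strip, (f p.1 p.2 * radialWeight p.1) ^ 2 with hA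
  set ρ : ℝ := ∫ θ in Ioo 0 (π / 2), R θ ^ 2 with hρ
  have hρle : ρ ≤ 7 / 10 := integral_sq_angularWeight_div_sub_le hα hα'
  have hprod : ∫ p in strip, R p.2 ^ 2 * (L p.1 / p.1) ^ 2 = X2 * ρ := by
    have e1 : ∫ p in strip, R p.2 ^ 2 * (L p.1 / p.1) ^ 2 =
        ∫ p in strip, (L p.1 / p.1) ^ 2 * R p.2 ^ 2 :=
      integral_congr_ae (Eventually.of_forall fun p => by ring)
    rw [e1, volume_restrict_strip, integral_prod_mul (f := fun z : ℝ => (L z / z) ^ 2)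
      (g := fun θ : ℝ => R θ ^ 2)]
    congr 1
    rw [hX2]
    refine setIntegral_eq_integral_of_forall_compl_eq_zero fun z hz => ?_
    have : z < a := lt_of_le_of_lt (not_lt.1 hz) ha
    simp [hLa z this]
  have hiG : IntegrableOn (fun p : ℝ × ℝ => (f p.1 p.2 * radialWeight p.1) ^ 2) strip := by
    have : (fun p : ℝ × ℝ => (f p.1 p.2 * radialWeight p.1) ^ 2) =
        fun p => f p.1 p.2 * (f p.1 p.2 * radialWeight p.1 ^ 2) := by funext p; ring
    rw [this]
    refine Integrable.integrableOn ?_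
    refine Continuous.integrable_of_hasCompactSupport ?_ (hs.mul_right)
    refine continuous_of_continuousOn_strip hKcl hsub (hfon.mul (hfon.mul (hwon.pow 2)))
      fun p hp => by simp [hf0 p hp]
  have hiRL : IntegrableOn (fun p : ℝ × ℝ => R p.2 ^ 2 * (L p.1 / p.1) ^ 2) strip := by
    rw [IntegrableOn, volume_restrict_strip]
    have h1 : Integrable (fun z : ℝ => (L z / z) ^ 2) (volume.restrict (Ioi 0)) := by
      refine (i5b.congr (Eventually.of_forall fun z => by ring)).integrableOn
    have h2 : Integrable (fun θ : ℝ => R θ ^ 2) (volume.restrict (Ioo 0 (π / 2))) :=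
      ((hRc.pow 2).integrableOn_Icc (a := 0) (b := π / 2)).mono_set Ioo_subset_Icc_self
    exact (h1.mul_prod h2).congr (Eventually.of_forall fun p => by ring)
  have step6 : 2 * |∫ p in strip, QR p| ≤ (1 / 4) * A + 4 * (X2 * ρ) := by
    have h1 : |∫ p in strip, QR p| ≤ ∫ p in strip, |QR p| := abs_integral_le_integral_abs
    have h2 : ∫ p in strip, 2 * |QR p| ≤
        ∫ p in strip, ((1 / 4) * (f p.1 p.2 * radialWeight p.1) ^ 2 +
          4 * (R p.2 ^ 2 * (L p.1 / p.1) ^ 2)) := by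
      refine setIntegral_mono_on (iQR.integrableOn.abs.const_mul 2)
        ((hiG.const_mul _).add (hiRL.const_mul _)) measurableSet_strip fun p _ => ?_
      have e : QR p = (f p.1 p.2 * radialWeight p.1) * (R p.2 * (L p.1 / p.1)) := by
        simp only [hQR]; ring
      rw [e, abs_mul]
      nlinarith [sq_nonneg (|f p.1 p.2 * radialWeight p.1| / 2 - 2 * |R p.2 * (L p.1 / p.1)|),
        sq_abs (f p.1 p.2 * radialWeight p.1), sq_abs (R p.2 * (L p.1 / p.1)),
        abs_nonneg (f p.1 p.2 * radialWeight p.1), abs_nonneg (R p.2 * (L p.1 / p.1))]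
    rw [integral_const_mul, integral_add (hiG.const_mul _) (hiRL.const_mul _), integral_const_mul,
      integral_const_mul, hprod] at h2
    linarith
  -- Step 7: conclude
  rw [step1, step2, step3, step4]
  have h7 : 4 * (X2 * ρ) ≤ (14 / 5) * X2 := by nlinarith
  have h8 : -(2 * ∫ p in strip, QR p) ≥ -((1 / 4) * A + 4 * (X2 * ρ)) := by
    have := abs_le.1 (show |∫ p in strip, QR p| ≤ ((1 / 4) * A + 4 * (X2 * ρ)) / 2 by linarith)
    linarith [this.2]
  nlinarith [step5, h7, h8, hX2nn]

end Elgindi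

end Literature.Analysis.FluidPDE
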